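import Summits.Schanuel.Schanuel.Theorems.RootDecomp1EUntwistedWall02

/-!
# RootDecomp1EUntwistedWall — lens 2, generation 41 «THE UNTWISTED 1-FOLD WALL BY TERM-COUNTING» (lane (P1) of critic RULING L1949 (5); GO + CHECKLIST E-g41 L1993; VERDICT L2040: CLEARED — ONE CELL (E-R18 (a″)) mod hE): `S` ITSELF with surplus one at the UNTWISTED twins `zTwin k β (q·ρ)` (`ρ` hyper-Liouville, `q ∈ ℚ^×`, `β ∈ ℚ(i) ∖ ℚ`, every `k ≥ 1`) and on the whole Gauss-curve class `InGaussCurveClass`, modulo the ONE registered published theorem `hE = EHLM2015_thm_2_1` (Ernvall-Hytönen–Leppälä–Matala-aho 2015, Thm 2.1, typed as a WEAKER few-term consequence over Gaussian-rational exponents) — «count TERMS, not DEGREE» — continuation (RootDecomp1EUntwistedWall03): §9 THE ENGINE `algebraicIndependent_gaussPt (hE) (hT : HyperLiouville T) (w) (e) (hLI)` : `AlgebraicIndependent ℚ (gaussPt w e T)` and the alias `algebraicIndependent_cons_exp_of_hyperLiouville` (+ the kernel's module docstring, verbatim)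

(lens-2 g41 HOME kernel UntwistedWall.lean 8d50f5c1…, 1431 l, import tree `RootDecomp1EWallDichotomy01` ONLY; Ctrl 1a8646c2… rc 1 at exactly nine lines C1–C9; Probe 491b1be0…; NODE-g41.md ab32189b…; NODE L2035 / REQUEST L2036 / ERRATUM L2037; writer re-check L2039; critic VERDICT L2040 (crit g8): CLEARED — ONE CELL (E-R18 (a″)) to lens-2, conditional «mod hE»; lens-2 tally cells ×3; RULE E-R19; PORT GO 01–0k `--supports stmt-Schanuel-31409`, statements/proofs verbatim, part 01 docstring of `EHLM2015_thm_2_1` amended by the critic's representation sentence and the `+1 → +2` exponent bookkeeping.)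
PORTED for the decomp-schanuel cell by the census instrument (gen 17), no census credit beyond the cell of record. Split in five parts for the 400-line cap (NODE §7 plan 01–04 with §1–§8 halved): 01 = §1 the registered fact `EHLM2015_thm_2_1` (the ONLY `def … : Prop` binder) + §2–§5 collapse data / identities / Lipschitz bound / distinct exponents and term count; 02 = §6–§8 integrality, sizes, endgame; 03 = §9 THE ENGINE `algebraicIndependent_gaussPt` (+ the kernel's module docstring); 04 = §10–§11 twins, the class `InGaussCurveClass`, the cells `cell_25020` / `cell_31409`, the member `z_U` and its separation from the point / scale / two-scale classes; 05 = §12–§13 the hypothesis-free Diophantine lemma `lambdaH_ne_pow_of_dyadicHyper₂`, `not_inLWClass_zU`, `zU_separation`, and the LIVE-item probes at `z_U`.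
PORT EDITS (statements and proofs otherwise VERBATIM): every undocumented helper received a one-line docstring; the tree-twin one-liners `isAlgebraic_I'`, `I_not_mem_range'`, `lambdaH_transcendental`, `lambdaH_ne_zero'`, `lambdaH_pos'`, `algebraicIndependent_tail'`, `abs_pow_succ_sub_le'` made `private` (copied privately into later parts where used); the two `Iff.rfl` READ-BACKS `defectOneSchanuel_iff` / `eStableDefectOne_iff` of K §13 are NOT re-landed (identical read-backs are already in the tree: `RootDecomp1EGenericScale05.defectOneSchanuel_iff` / `.eStableDefectOne_iff`); the positional probes `item25020_at_zU`, `item31409_at_zU`, `cell_25020_of_defectOneSchanuel`, `eStableDefectOne_at_zU (h : EStableDefectOne)`, `eStableDefectOne_body_at_zU_of_hE` are kept. Items 31409 / 25020 / 31410 stay OPEN (rung 0); nothing here proves `S`.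
-/

noncomputable section

open Complex Polynomial IntermediateField
open scoped BigOperators

open Summit.Schanuel.Schanuel.Theorems.RootDecomp1KHyper (SB SFset exists_ball_eval_ne_zero
  exists_int_mul_eq_map mvaeval_int_map sb_of_algebraicIndependent mem_adjoin_SFset_I')
open Summit.Schanuel.Schanuel.Theorems.RootDecomp1KHyper.HyperCell (HyperLiouville lambdaH
  hyperLiouville_lambdaH hexp one_le_hexp summable_lambdaH)
open Summit.Schanuel.Schanuel.Theorems.RootDecomp1ELWTransport (zTwin zTwin_left zTwin_right
  linearIndependent_zTwin dblMoments InLWClass DyadicHyper₂)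
open Summit.Schanuel.Schanuel.Theorems.RootDecomp1EScaleTransfer (InScaleClass HyperScaleApprox)
open Summit.Schanuel.Schanuel.Theorems.RootDecomp1ETwoScale (CoveredTower InTwoScaleClass)
open Summit.Schanuel.Schanuel.Theorems.RootDecomp1EPointTransfer (InPointClass lambdaH_rat_lower
  lambdaH_sub_rat_lower)
open Summit.Schanuel.Schanuel.Theorems.RootDecomp1EWallDichotomy (InTwistedFrameClass transcendental_complex
  transcendental_of_hyperLiouville not_linearIndependent_zTwin_ratCast twinExpo twinExpo_left twinExpo_right)
open Summit.Schanuel.Schanuel.Theorems.RootDecomp1BHyperFrame (trdeg_adjoin_le_of_isAlgebraic')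
open Summit.Schanuel.Schanuel.Theorems.RootDecomp1BDefectFloorCells (natCast_le_trdeg_of_algebraicIndependent)

namespace Summit.Schanuel.Schanuel.Theorems.RootDecomp1EUntwistedWall

variable {n : ℕ}

/-!
# RootDecomp1EUntwistedWall — lens 2, generation 41 «THE UNTWISTED 1-FOLD WALL via the LACUNARY
BAKER–MAHLER FORM» (lane (P1) of critic RULING L1949 (5); GO + CHECKLIST E-g41 = L1993; writer ACK L1999)

Node file of the «structural dichotomy (special vs generic)» seat (decomp-schanuel, lens 2, generation 41) for
`route-Schanuel-RootDecomp1E`, items `EStableDefectOne` (stmt-Schanuel-31409) / `DefectOneSchanuel` (25020).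
CLAIM: HOME bus STATUS L1989.  Namespace `Summit.Schanuel.Schanuel.Theorems.RootDecomp1EUntwistedWall`.
ONE registered print theorem `hE : EHLM2015_thm_2_1` (§1) is the ONLY `def … : Prop` hypothesis of the file
(no `hLW`, no `hRoy`, no `hX`, no `hNW`, no `h52`); everything not marked «mod hE» is hypothesis-free.

## The wall of record, (c⁗), and the target

(c⁗) WALL TEXT OF RECORD (critic RULING L1949 (3), writer L1999): «LW-pair/finite-type wall at 1-fold scales = the
UNTWISTED scales: `T` whose hyper-approximants have algebraic parts `θ` with `zTwin k β θ` ℚ-DEPENDENT (model case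
`T ∈ ℚ·HyperLiouville`: the approximant frames collide onto `(e^{1/N})`, so a pair measure for `(e, e^β)`-type
points POLYNOMIAL IN THE DEGREE is needed — not in print: Ably 1994 / Roy 2014 doubly exponential in deg, Mahler
1932 only for `log log H ≥ c·d^{2n}`, Sert 1999 acq-04524 pending); TWISTED 1-fold scales decided with surplus one
mod hRoy (g40); 2-fold untwisted scales `T ∈ DyadicHyper₂` decided by transport (g39, mod hLW)» — with the rider
(L1999) «untwisted model case `T ∈ ℚ^×·HyperLiouville`, `β ∈ ℚ(i)∖ℚ` CLAIMED decidable mod hE (EHLM 2015 Thm 2.1)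
by term-counting (lens-2 g41, checklist E-g41; booked only at verdict)».
TARGET (P1): `S` ITSELF at `zTwin k β T` for `T ∈ ℚ^×·HyperLiouville`, `β ∈ ℚ(i) ∖ ℚ`, every `k ≥ 1`, mod `hE` only.

## The observation: count TERMS, not DEGREE (why the pair-measure wall is not load-bearing)

Collapse a hypothetical relation `P(T, e^{w₁T^{e₁}}, …, e^{w_nT^{e_n}}) = 0` (`P ∈ ℤ[x₀,…,x_n] ∖ 0`,
`w_l ∈ ℚ(i)`, `e_l ∈ ℕ`) at a rational approximant `r = a/N` of `T`: `P(r, e^{w_l r^{e_l}})` is a LINEAR FORM IN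
EXPONENTIALS `Σ_s c_s(r) e^{⟨s, w r^{e}⟩}` whose exponents `Σ_l s_l w_l r^{e_l}` lie in the FIXED field `𝕀 = ℚ(i)`
with common denominator `den(w)·N^{Σ e_l}`, whose coefficients `c_s(r) = Σ_j p_{j,s} r^j` are rationals of height
`≤ c·N^{deg P}`, and — the point — whose NUMBER OF TERMS is at most `#supp P`, INDEPENDENT OF `N`.  Baker–Mahler
type lower bounds for such forms (Baker 1965; Mahler 1975, Sankilampi 2009 explicit; Ernvall-Hytönen–Leppälä–
Matala-aho 2015 over an imaginary quadratic `𝕀`, the registered `hE`) are, for a FIXED number of terms,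
POLYNOMIAL in the heights and in the denominator: `|Λ| ≥ exp(−(size)^κ)`, `κ = κ(#terms)`, i.e. `≥ exp(−C·N^{K})`
with `K` independent of `N` (THE DEGREE LAW).  Against it, hyper-Liouville approximation `|T − a/N| < exp(−N^m)`
for every `m` makes `|Λ| ≤ L·exp(−N^m)` (Lipschitz).  Choosing `m > K` contradicts — provided the collapsed
FORM is non-zero (a non-zero `Finsupp` on `ℚ × ℚ`; `hE` bounds the value of a non-zero FORM, so no analytic
zero-counting is needed).  That is ROOT AVOIDANCE by a POLYNOMIAL: the approximant is taken in a ball around `T`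
free of the finitely many roots of `Q = fib_P(tail t) · ∏ diffPoly` (tree `exists_ball_eval_ne_zero`), so that
distinct exponent multi-indices give distinct collapsed exponents (`diffPoly_ne_zero`, from the freeness
hypothesis `hLI`) and the fibre coefficient over the exponent of a support element `t` of `P` is
`fib_P(tail t)(r) ≠ 0` (§5).  No Lindemann–Weierstrass PAIR measure, no degree growth, no norm, no transport, no 2-fold
hypothesis: the (c⁗) obstruction «pair measure polynomial in the degree — not in print» is bypassed, not met.
ℚ^×-rescaling `T ↦ qT` is absorbed into the Gaussian weights (`wTwin`, §10), so no lemma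
«`ℚ^× · HyperLiouville ⊆ HyperLiouville`» is needed or claimed.

## Contents

* §1 `EHLM2015_thm_2_1` — the registered fact, print-faithful-or-WEAKER, derivation line by line in its docstring.
* §2–§8 the collapse machinery: `gaussPt w e x = (x, e^{w_l x^{e_l}})`, the collapsed form `lacForm`, its value
  (`lacEval_lacForm`), Lipschitz (`exists_lipschitz_FG`), support/cardinality (`card_support_lacForm_le`),
  integrality of exponents (`isZ_expo`), the size bound `lacSize_lacForm_le` (polynomial in `N`), `endgame`.
* §9 THE ENGINE `algebraicIndependent_gaussPt (hE) (hT : HyperLiouville T) (w) (e) (hLI)` :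
  `AlgebraicIndependent ℚ (gaussPt w e T)` — obligations visible: `hLI : LinearIndependent ℤ (l ↦ monomial (e l) (gι (w l)))`
  (the exponent monomials are ℤ-free, i.e. distinct collapsed exponents for distinct multi-indices); alias
  `algebraicIndependent_cons_exp_of_hyperLiouville` in the `Fin.cons T (l ↦ e^{w_l T^{e_l}})` spelling.
* §10 TWINS: `wTwin k q b₁ b₂` (weights `q^j`, `q^j(b₁+ib₂)`), `linearIndependent_twinMonomials` (needs `q ≠ 0`,
  `b₂ ≠ 0`), `algebraicIndependent_twin`, the SURPLUS-ONE cell `succ_le_trdeg_zTwin_untwisted (hE) (hρ) (hk : 0 < k)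
  (hq : q ≠ 0) (b₁) (hb₂ : b₂ ≠ 0) : ((k+k+1 : ℕ) : Cardinal) ≤ trdeg_ℚ ℚ(zTwin k (b₁+ib₂) (qρ), exp)` and the FLAGSHIP
  `schanuel_zTwin_untwisted … : SB (k+k) (zTwin k (gι (b₁,b₂)) ((q:ℝ)·ρ))` = `S` ITSELF, mod `hE` only.
* §11 the class `InGaussCurveClass z` (`z_l = w_l T^{e_l}`, `T` hyper-Liouville, monomials ℤ-free) with `S` on it at
  every length (`schanuel_inGaussCurveClass`), the item cells `cell_25020 (hE)` / `cell_31409 (hE)` (item binders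
  VERBATIM, class line added — the items themselves are NOT derived), and the MEMBER `zU = zTwin 2 I lambdaH`
  (`λ_H` = lens 6's explicit hyper-Liouville number): `five_le_trdeg_zU (hE)`, `four_le_trdeg_zU (hE) : SB (2+2) zU`.
* §12 SEPARATION (hypothesis-free): `zU_separation : zU ∉ InPointClass ∧ zU ∉ InScaleClass ∧ zU ∉ InTwoScaleClass ∧
  zU ∉ InLWClass ∧ ∀ β, ¬ LinearIndependent ℚ (zTwin 2 β 1)` — tree names `RootDecomp1EPointTransfer.InPointClass`
  (g36), `RootDecomp1EScaleTransfer.InScaleClass` (g35), `RootDecomp1ETwoScale.InTwoScaleClass` (g37),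
  `RootDecomp1ELWTransport.InLWClass` (g39); the new Diophantine input is `lambdaH_ne_pow_of_dyadicHyper₂`
  («`λ_H` is not a power of a dyadic 2-fold hyper-Liouville number», from the tree's irrationality measures of `λ_H`).

## Certificate BEFORE / AFTER (items 31409 / 25020 stay OPEN, rung 0)

BEFORE (STANDING-RECORD §12–§13): decided explicit classes `InScaleClass` (g35, mod hLW), `InPointClass` (g36, mod
hLW/hRoy), `InTwoScaleClass` (g37, defect ≤ 1), `InLWClass` (g39, 2-fold dyadic, mod hLW), `InTwistedFrameClass` (g40,
mod hRoy); wall (c⁗): «untwisted 1-fold scales OPEN».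
AFTER: additionally the UNTWISTED TWIN CLASS `{zTwin k β T : k ≥ 1, β ∈ ℚ(i)∖ℚ, T ∈ ℚ^×·HyperLiouville}` — indeed the
whole `InGaussCurveClass` (Gaussian-rational weights, arbitrary exponent patterns with ℤ-free monomials, 1-fold
hyper-Liouville `T`) — DECIDED (S itself, surplus one) mod `hE`.
STILL OPEN (stated, not claimed): (i) `T` merely Liouville / of finite hyper-order (the engine uses `|T − a/N| <
exp(−N^m)` for `m > K(P)`, unbounded in `deg P`); (ii) `β ∉ ℚ(i)`: real quadratic and general algebraic `β` (EHLM is an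
imaginary-quadratic theorem: the lattice `ℤ_𝕀` is load-bearing in its Siegel lemma; other imaginary quadratic `𝕀′`
would be the VARIANT ×0 of E-R19); (iii) transcendental weights / two independent scales; (iv) the induction STEP of
31409 and the items themselves; (v) the dark tuples `λ(1,β,β²,β³)`, `(1,i,π,iπ)` of the record.

## The member's position and the twisted-frame question (said openly)

`zU = (λ_H, λ_H², iλ_H, iλ_H²)` is ℚ-free, E-stable (`β = i`), of the untwisted model case (`θ = 1`), and separated
BY TREE NAMES from the four decided classes g35/g36/g37/g39 (`zU_separation`, hypothesis-free).  Versus g40's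
`InTwistedFrameClass`: the representation through its OWN scale collides (`zU_frame_collides`: `zTwin 2 β 1` is
ℚ-dependent for every `β` — g40's `not_linearIndependent_zTwin_ratCast`), but membership through some OTHER
representation `λ_H^j = θ_j ρ^{e_j}` (`θ_j` algebraic, `ρ` hyper-Liouville) is an OPEN Diophantine question about
`λ_H`, NOT claimed either way here.  INPUT CURRENCY: on any overlap with g40's class this cell replaces the currency
`hLW ∧ hRoy` by the single fact `hE`; on the untwisted model case proper (the (c⁗) wall) nothing was decided before.

## Novelty and presearch (labels as recorded in NOTES.md / NODE-g41.md §7)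

Mechanism = NEW-COMBINATION-LOCAL: few-term (lacunary) 𝕀-Baker–Mahler bound [corpus: paper:arxiv-1309.6053 p0004]
× hyper-Liouville rational collapse, for MOMENT exponent patterns.  Print antecedents of the COLLAPSE step (values
at well-approximable `ξ` from measures at algebraic points): Mordukhay-Boltovskoy 1927, Mahler 1930, Galochkin 1972
(`ξ, e^ξ`; acq-15000), Väänänen 1976 (`ξ, f₁(ξ), …, f_s(ξ)` for algebraically independent Siegel E-functions;
zbl:0431.10020, acq-15037) [corpus: paper:url-c5d5a5094890 p0006–p0008, p0010–p0011 = Waldschmidt, LNM 1415 (1990)];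
hence the exponent-pattern-≡1 slice (`k = 1`: `(T, βT)`) has a PRINT ANTECEDENT CLASS (E-functions `e^{wz}`) and is
merely re-derived here mod `hE`; patterns with an exponent `≥ 2` (all `k ≥ 2`, the member) are outside the
single-point E-function theorems (`z ↦ e^{z²}` is not an E-function) and outside the LW-measure route (doubly
exponential in degree: Sert 1999 ∈ Ably class [corpus: paper:arxiv-1607.00579 p0002]).  Nulls (corpus fts/vec,
galaxy all stars) listed in NODE-g41.md §7.  Bib: `ErnvallhytonenLeppalaMatalaaho2013` (ledger bib).
-/

/-! ## §9  THE ENGINE: Gaussian-twisted curve points at hyper-Liouville parameters are algebraically free -/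

/-- Each exponent of a support monomial is at most the total degree (tree one-liner, private copy). -/
private theorem apply_le_totalDegree' {P : MvPolynomial (Fin (n + 1)) ℤ} {s : Fin (n + 1) →₀ ℕ}
    (hs : s ∈ P.support) (i : Fin (n + 1)) : s i ≤ P.totalDegree := by
  refine le_trans ?_ (MvPolynomial.le_totalDegree hs)
  by_cases hi : i ∈ s.support
  · exact Finset.single_le_sum (f := fun j => s j) (fun _ _ => Nat.zero_le _) hi
  · simp [Finsupp.notMem_support_iff.mp hi]

/-- **ENGINE (E-g41).**  `hE` = [EHLM2015, Thm 2.1] (registered print theorem), `T` hyper-Liouville (tree class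
`HyperLiouville`), `w_l ∈ ℚ(i)`, `e_l ∈ ℕ` with the `w_l X^{e_l}` `ℤ`-free in `ℂ[X]` (FREENESS = distinct collapsed
exponents).  THEN `T, e^{w₁T^{e₁}}, …, e^{w_nT^{e_n}}` are ALGEBRAICALLY INDEPENDENT over `ℚ`.
Mechanism: a relation `P = 0` collapsed at a rational approximant `r = a/N` of `T` is a LACUNARY Baker–Mahler form
with `≤ #supp P` terms (independent of `N`), Gaussian exponents of denominator `wden·N^{Σe}`, integer coefficients
`≤ c·N^D`: `|Λ| ≥ exp(−(C₁N^{K₁})^κ)` by `hE` (POLYNOMIAL in `N` — the degree law that makes a 1-fold cell possible)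
against `|Λ| = N^D|F(r) − F(T)| ≤ N^D·M·exp(−N^m)` for every `m`. -/
theorem algebraicIndependent_gaussPt (hE : EHLM2015_thm_2_1) {T : ℝ} (hT : HyperLiouville T)
    (w : Fin n → ℚ × ℚ) (e : Fin n → ℕ)
    (hLI : LinearIndependent ℤ (fun l : Fin n => Polynomial.monomial (e l) (gι (w l)))) :
    AlgebraicIndependent ℚ (gaussPt w e (T : ℂ)) := by
  classical
  by_contra hdep
  -- an integer relation `P(T, e^{w_l T^{e_l}}) = 0`, `P ≠ 0`
  obtain ⟨P, hP0, hPu⟩ : ∃ P : MvPolynomial (Fin (n + 1)) ℤ, P ≠ 0 ∧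
      MvPolynomial.aeval (gaussPt w e (T : ℂ)) P = 0 := by
    have h1 : ¬ Function.Injective
        (MvPolynomial.aeval (gaussPt w e (T : ℂ)) : MvPolynomial (Fin (n + 1)) ℚ →ₐ[ℚ] ℂ) := hdep
    rw [injective_iff_map_eq_zero] at h1
    push Not at h1
    obtain ⟨g, hg0, hgne⟩ := h1
    obtain ⟨N, G, hN, hG⟩ := exists_int_mul_eq_map g
    refine ⟨G, ?_, ?_⟩
    · intro hG0
      rw [hG0, map_zero] at hG
      have hC : (MvPolynomial.C (N : ℚ) : MvPolynomial (Fin (n + 1)) ℚ) ≠ 0 :=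
        MvPolynomial.C_eq_zero.not.mpr (by exact_mod_cast hN)
      exact (mul_ne_zero hC hgne) hG.symm
    · rw [← mvaeval_int_map _ G, hG, map_mul, MvPolynomial.aeval_C, hg0, mul_zero]
  have hFT : FG P w e T = 0 := by rw [FG_eq_aeval]; exact hPu
  -- degree, support size, a support element, the exponent of `hE`
  set D : ℕ := P.totalDegree with hDdef
  have hD : ∀ s ∈ P.support, ∀ i, s i ≤ D := fun s hs i => apply_le_totalDegree' hs i
  have hD0 : ∀ s ∈ P.support, s 0 ≤ D := fun s hs => hD s hs 0
  set S : ℕ := P.support.card with hSdef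
  obtain ⟨κ, hκ⟩ := hE S
  obtain ⟨t, ht⟩ : ∃ t, t ∈ P.support := by
    obtain ⟨t, ht⟩ := MvPolynomial.ne_zero_iff.mp hP0
    exact ⟨t, MvPolynomial.mem_support_iff.mpr ht⟩
  -- ROOT AVOIDANCE: fibre polynomial × all difference polynomials, non-zero by freeness
  set Q : ℂ[X] := (fib P (tail t)).map (algebraMap ℤ ℂ) *
      ∏ p ∈ (P.support ×ˢ P.support).filter (fun p => tail p.1 ≠ tail p.2),
        diffPoly w e (tail p.1) (tail p.2) with hQ
  have hQ0 : Q ≠ 0 := by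
    refine mul_ne_zero ((Polynomial.map_ne_zero_iff (RingHom.injective_int _)).mpr (fib_ne_zero P ht)) ?_
    rw [Finset.prod_ne_zero_iff]
    intro p hp
    exact diffPoly_ne_zero hLI (Finset.mem_filter.mp hp).2
  obtain ⟨δ₀, hδ₀, hball⟩ := exists_ball_eval_ne_zero Q hQ0 T
  -- local Lipschitz bound of `F` at `T`
  obtain ⟨Kl, δ₁, hKl0, hδ₁, hlip⟩ := exists_lipschitz_FG P w e T
  set M : ℝ := Kl + 1 with hM
  have hM0 : 0 < M := by rw [hM]; linarith
  -- constants (depend on `T, w, e, P` only)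
  obtain ⟨K₁, hK₁⟩ : ∃ K₁ : ℕ, K₁ = (∑ l, e l) + D := ⟨_, rfl⟩
  set R : ℝ := |T| + 1 with hR
  have hR1 : 1 ≤ R := by rw [hR]; linarith [abs_nonneg T]
  have hR0 : 0 ≤ R := zero_le_one.trans hR1
  have hWb0 : 0 ≤ Wb w e R := Wb_nonneg w e hR0
  set Lr : ℝ := ∑ s ∈ P.support, |((MvPolynomial.coeff s P : ℤ) : ℝ)| with hLr
  have hLr0 : 0 ≤ Lr := Finset.sum_nonneg fun s _ => abs_nonneg _
  have hS0 : (0 : ℝ) ≤ S := Nat.cast_nonneg S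
  have hDr0 : (0 : ℝ) ≤ D := Nat.cast_nonneg D
  have hw0 : (0 : ℝ) ≤ wden w := Nat.cast_nonneg _
  set C₁ : ℝ := 2 + (wden w : ℝ) + S * ((D : ℝ) * Wb w e R + Lr * R ^ D) with hC₁
  have hC₁0 : 0 ≤ C₁ := by rw [hC₁]; positivity
  have hCκ : 0 ≤ C₁ ^ κ := pow_nonneg hC₁0 κ
  set A : ℝ := C₁ ^ κ + D + M + 1 + |Real.log δ₀| + |Real.log δ₁| with hA
  have habs0 := abs_nonneg (Real.log δ₀)
  have habs1 := abs_nonneg (Real.log δ₁)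
  have hAend : C₁ ^ κ + D + M ≤ A := by rw [hA]; linarith
  have hA0 : 0 ≤ A := by linarith [hM0.le]
  set m : ℕ := ⌈A⌉₊ + (K₁ * κ + 2) with hm
  have hm0 : 0 < m := by rw [hm]; positivity
  have hm2 : 2 ≤ m := by rw [hm, ← add_assoc]; exact Nat.le_add_left 2 _
  -- the approximation `r`: `den r ≥ m`, `|T − r| < exp(−den(r)^m)`
  obtain ⟨r, hden, hne, hlt⟩ := hT m
  have hN2 : 2 ≤ r.den := hm2.trans hden
  have hN1 : 1 ≤ r.den := le_trans (by norm_num) hN2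
  have hN1r : (1 : ℝ) ≤ r.den := by exact_mod_cast hN1
  have hN2r : (2 : ℝ) ≤ r.den := by exact_mod_cast hN2
  have hNC : (r.den : ℂ) ≠ 0 := by exact_mod_cast r.den_nz
  have hAm : A ≤ m := by
    rw [hm, Nat.cast_add]
    have := Nat.le_ceil A
    linarith [(Nat.cast_nonneg (K₁ * κ + 2) : (0 : ℝ) ≤ ((K₁ * κ + 2 : ℕ) : ℝ))]
  have hmN : (m : ℝ) ≤ r.den := by exact_mod_cast hden
  set η : ℝ := |T - r| with hη
  have hη0 : 0 < η := abs_pos.mpr (sub_ne_zero.mpr hne)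
  have hηlt : η < Real.exp (-((r.den : ℝ) ^ m)) := hlt
  have hNm1 : (r.den : ℝ) ≤ (r.den : ℝ) ^ m := le_self_pow₀ hN1r hm0.ne'
  have hηA : η < Real.exp (-A) := hηlt.trans_le (Real.exp_le_exp.mpr (by linarith))
  have hη_of : ∀ x : ℝ, 0 < x → |Real.log x| ≤ A → η < x := by
    intro x hx hlx
    refine hηA.trans_le ?_
    calc Real.exp (-A) ≤ Real.exp (Real.log x) :=
          Real.exp_le_exp.mpr (by linarith [neg_abs_le (Real.log x)])
      _ = x := Real.exp_log hx
  have hηδ₀ : η < δ₀ := hη_of δ₀ hδ₀ (by rw [hA]; linarith [hM0.le])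
  have hηδ₁ : η < δ₁ := hη_of δ₁ hδ₁ (by rw [hA]; linarith [hM0.le])
  have hη1 : η ≤ 1 := by
    refine hηA.le.trans ?_
    rw [Real.exp_le_one_iff]; linarith
  have hrR : |(r : ℝ)| ≤ R := by
    have h1 : |(r : ℝ)| ≤ |T| + |T - r| := by
      calc |(r : ℝ)| = |T - (T - r)| := by ring_nf
        _ ≤ |T| + |T - r| := abs_sub _ _
    rw [hR]; linarith
  -- root avoidance at `r`: distinct exponents for distinct exponential parts, non-zero fibre value
  have hQr : Q.eval ((r : ℝ) : ℂ) ≠ 0 :=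
    hball r (fun h => hne h.symm) (by rw [abs_sub_comm]; exact hηδ₀)
  rw [Complex.ofReal_ratCast, hQ, Polynomial.eval_mul, mul_ne_zero_iff, Polynomial.eval_prod,
    Finset.prod_ne_zero_iff] at hQr
  obtain ⟨hfibr, hdiffr⟩ := hQr
  have hdist : ∀ s ∈ P.support, ∀ s' ∈ P.support,
      expo w e r s = expo w e r s' → tail s = tail s' := by
    intro s hs s' hs' h
    refine tail_eq_of_expo_eq (fun hts => ?_) h
    exact hdiffr (s, s') (Finset.mem_filter.mpr ⟨Finset.mem_product.mpr ⟨hs, hs'⟩, hts⟩)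
  have hfib : Polynomial.aeval (r : ℂ) (fib P (tail t)) ≠ 0 := by
    rwa [Polynomial.eval_map_algebraMap] at hfibr
  -- THE FORM `Λ_r` is non-zero, has ≤ S + 1 terms, exponents of denominator `wden · den(r)^{Σe}`
  have hf0 : lacForm P D w e r ≠ 0 := by
    intro h0
    have h1 := lacForm_apply_expo P D hdist ht
    rw [h0, Finsupp.zero_apply] at h1
    have h2 := sum_coef_fibre_cast P hD0 r (tail t)
    rw [← h1, Int.cast_zero] at h2
    exact (mul_ne_zero (pow_ne_zero _ hNC) hfib) h2.symm
  have hcardf : (lacForm P D w e r).support.card ≤ S + 1 :=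
    (card_support_lacForm_le P D w e r).trans (Nat.le_succ _)
  have hd0 : 0 < wden w * r.den ^ (∑ l, e l) := Nat.mul_pos (wden_pos w) (pow_pos r.den_pos _)
  have hdint : ∀ γ ∈ (lacForm P D w e r).support,
      (∃ z : ℤ, ((wden w * r.den ^ (∑ l, e l) : ℕ) : ℚ) * γ.1 = z) ∧
        (∃ z : ℤ, ((wden w * r.den ^ (∑ l, e l) : ℕ) : ℚ) * γ.2 = z) := by
    intro γ hγ
    obtain ⟨s, hs, rfl⟩ := Finset.mem_image.mp (support_lacForm_subset P D w e r hγ)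
    exact isZ_expo w e r s
  -- LOWER BOUND (the registered fact)
  have hlow := hκ (lacForm P D w e r) (wden w * r.den ^ (∑ l, e l)) hf0 hcardf hd0 hdint
  -- UPPER BOUND (collapse identity + Lipschitz)
  have hup : ‖lacEval (lacForm P D w e r)‖ ≤ (r.den : ℝ) ^ D * M * η := by
    rw [lacEval_lacForm P hD0, norm_mul, norm_pow, Complex.norm_natCast]
    have h1 : ‖FG P w e r‖ ≤ M * η := by
      have h2 := hlip r (by rw [abs_sub_comm]; exact hηδ₁)
      rw [hFT, sub_zero, abs_sub_comm] at h2
      calc ‖FG P w e r‖ ≤ Kl * η := h2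
        _ ≤ M * η := mul_le_mul_of_nonneg_right (by rw [hM]; linarith) hη0.le
    calc (r.den : ℝ) ^ D * ‖FG P w e r‖ ≤ (r.den : ℝ) ^ D * (M * η) := by gcongr
      _ = (r.den : ℝ) ^ D * M * η := by ring
  -- SIZE BOUND: `B ≤ C₁ · den(r)^{K₁}`
  have hB : lacSize (lacForm P D w e r) (wden w * r.den ^ (∑ l, e l)) ≤ C₁ * (r.den : ℝ) ^ K₁ := by
    have h1 := lacSize_lacForm_le P hD w e r hR1 hrR (wden w * r.den ^ (∑ l, e l))
    have hK1 : (1 : ℝ) ≤ (r.den : ℝ) ^ K₁ := one_le_pow₀ hN1r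
    have hKe : (r.den : ℝ) ^ (∑ l, e l) ≤ (r.den : ℝ) ^ K₁ := pow_le_pow_right₀ hN1r (by omega)
    have hKD : (r.den : ℝ) ^ D ≤ (r.den : ℝ) ^ K₁ := pow_le_pow_right₀ hN1r (by omega)
    have hdr : ((wden w * r.den ^ (∑ l, e l) : ℕ) : ℝ) = (wden w : ℝ) * (r.den : ℝ) ^ (∑ l, e l) := by
      push_cast; ring
    rw [hdr] at h1
    have t1 : (2 : ℝ) ≤ 2 * (r.den : ℝ) ^ K₁ := by linarith
    have t2 : (wden w : ℝ) * (r.den : ℝ) ^ (∑ l, e l) ≤ (wden w : ℝ) * (r.den : ℝ) ^ K₁ :=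
      mul_le_mul_of_nonneg_left hKe hw0
    have t3 : (S : ℝ) * ((D : ℝ) * Wb w e R) ≤ (S : ℝ) * ((D : ℝ) * Wb w e R) * (r.den : ℝ) ^ K₁ :=
      le_mul_of_one_le_right (by positivity) hK1
    have t4 : (S : ℝ) * (Lr * (R ^ D * (r.den : ℝ) ^ D)) ≤ (S : ℝ) * (Lr * R ^ D) * (r.den : ℝ) ^ K₁ := by
      have : (S : ℝ) * (Lr * (R ^ D * (r.den : ℝ) ^ D)) = (S : ℝ) * (Lr * R ^ D) * (r.den : ℝ) ^ D := by
        ring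
      rw [this]
      exact mul_le_mul_of_nonneg_left hKD (by positivity)
    rw [hC₁]
    linarith [h1, t1, t2, t3, t4]
  have hB0 : 0 ≤ lacSize (lacForm P D w e r) (wden w * r.den ^ (∑ l, e l)) := by
    unfold lacSize
    exact add_nonneg (by positivity) (Finset.sum_nonneg fun γ _ => by positivity)
  have hBκ : (lacSize (lacForm P D w e r) (wden w * r.den ^ (∑ l, e l))) ^ κ ≤
      C₁ ^ κ * (r.den : ℝ) ^ (K₁ * κ) := by
    calc (lacSize (lacForm P D w e r) (wden w * r.den ^ (∑ l, e l))) ^ κ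
        ≤ (C₁ * (r.den : ℝ) ^ K₁) ^ κ := pow_le_pow_left₀ hB0 hB κ
      _ = C₁ ^ κ * (r.den : ℝ) ^ (K₁ * κ) := by rw [mul_pow, ← pow_mul]
  have hchain : Real.exp (-(C₁ ^ κ * (r.den : ℝ) ^ (K₁ * κ))) ≤ (r.den : ℝ) ^ D * M * η :=
    calc Real.exp (-(C₁ ^ κ * (r.den : ℝ) ^ (K₁ * κ)))
        ≤ Real.exp (-(lacSize (lacForm P D w e r) (wden w * r.den ^ (∑ l, e l))) ^ κ) :=
          Real.exp_le_exp.mpr (by linarith)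
      _ ≤ ‖lacEval (lacForm P D w e r)‖ := hlow
      _ ≤ _ := hup
  -- GROWTH: `A · N^{K₁κ+1} < N^m`
  have hpowA : A ≤ (r.den : ℝ) ^ ⌈A⌉₊ :=
    calc A ≤ ⌈A⌉₊ := Nat.le_ceil A
      _ ≤ (2 : ℝ) ^ ⌈A⌉₊ := by exact_mod_cast (Nat.lt_two_pow_self).le
      _ ≤ (r.den : ℝ) ^ ⌈A⌉₊ := pow_le_pow_left₀ (by norm_num) hN2r _
  have hgrow : A * (r.den : ℝ) ^ (K₁ * κ + 1) < (r.den : ℝ) ^ m := by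
    have hsplit : (r.den : ℝ) ^ m = (r.den : ℝ) ^ ⌈A⌉₊ * ((r.den : ℝ) ^ (K₁ * κ + 1) * r.den) := by
      rw [hm]; ring
    rw [hsplit]
    have hpos : 0 < (r.den : ℝ) ^ ⌈A⌉₊ * (r.den : ℝ) ^ (K₁ * κ + 1) := by positivity
    calc A * (r.den : ℝ) ^ (K₁ * κ + 1) ≤ (r.den : ℝ) ^ ⌈A⌉₊ * (r.den : ℝ) ^ (K₁ * κ + 1) :=
          mul_le_mul_of_nonneg_right hpowA (by positivity)
      _ < (r.den : ℝ) ^ ⌈A⌉₊ * (r.den : ℝ) ^ (K₁ * κ + 1) * r.den :=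
          lt_mul_of_one_lt_right hpos (by linarith)
      _ = (r.den : ℝ) ^ ⌈A⌉₊ * ((r.den : ℝ) ^ (K₁ * κ + 1) * r.den) := by ring
  exact endgame hN2r hC₁0 hM0 hηlt hAend hgrow hchain

/-- **THE ENGINE under the checklist name** (E-g41 (2)): `T, e^{w_1 T^{e_1}}, …, e^{w_n T^{e_n}}` are
algebraically independent over `ℚ` for `T` hyper-Liouville, `w_l ∈ ℚ(i)` (`w_l` read as `w_l.1 + w_l.2·i`),
`e_l ∈ ℕ`, the monomials `w_l X^{e_l}` `ℤ`-free — mod `hE` (EHLM 2015 Thm 2.1).  Same term as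
`algebraicIndependent_gaussPt` (`gaussPt w e T` is this `Fin.cons` by definition). -/
theorem algebraicIndependent_cons_exp_of_hyperLiouville (hE : EHLM2015_thm_2_1) {T : ℝ} (hT : HyperLiouville T)
    (w : Fin n → ℚ × ℚ) (e : Fin n → ℕ)
    (hLI : LinearIndependent ℤ (fun l : Fin n => Polynomial.monomial (e l) (gι (w l)))) :
    AlgebraicIndependent ℚ
      (Fin.cons (T : ℂ) (fun l : Fin n => cexp (gι (w l) * (T : ℂ) ^ (e l))) : Fin (n + 1) → ℂ) :=
  algebraicIndependent_gaussPt hE hT w e hLI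

end Summit.Schanuel.Schanuel.Theorems.RootDecomp1EUntwistedWall
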